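import Summits.NavierStokesRegularity.NavierStokesRegularity.Theorems.ScenarioCensusSubRows
import HarnessLib

/-!
# Blow-up scenario census — OPEN sub-row A8per (time-periodic helical bounded ancient mild solutions), typed,
# with its two PROVED lattice edges `row_A8per_of_row_A8` and `row_A8per_of_row_A8rec`

Typer seat ns-census-typer-1 g6 (scope of the census KEY text: «one `def Row_<k> : Prop` per OPEN row»; the row A8per was
booked at census v1.37/v1.38 — ref PRE-CHECK ✓ 11:36Z, critic idea-crit-3 CONFORMS 11:27:20Z, lit label 11:30Z — but its key was so far
an ideator-file declaration, and `CENSUS-FINAL.md` r4 §2 lists the edges `row_A8per_of_row_A8` / `row_A8per_of_row_A8rec` as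
FILES-ONLY).  Sources (bodies VERBATIM, binders spelled out as in `ScenarioCensusSubRows.lean`: `E3 = EuclideanSpace ℝ (Fin 3)`,
`e3 = EuclideanSpace.single 2 1`):
* `Row_A8per` — ns-idea-3 LINE 3 «cesaro-calm», `pub/ideators/ns-idea-3/lines/cesaro-calm/line-cesaro-calm.rev2.lean` sha16
  edd609e9c27d3d9d :223 (identical in the current rev, c2e5009781468efd :242); glue `row_A8per_of_row_A8` :251 there;
* `pairVar_self`, `periodic_iter`, `isUniformlyRecurrent_of_periodic`, `row_A8per_of_row_A8rec` — ns-idea-3 «backward-hull»,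
  `pub/ideators/ns-idea-3/lines/backward-hull/line-backward-hull.lean` sha16 628cd57f5ba5c23e :317 / :321 / :339 / :361
  (the tree's `pairVar`, `IsUniformlyRecurrent`, `Row_A8rec` of `ScenarioCensusSubRows.lean` are that line's vocabulary).
The row is an `@[conjecture]` obligation node — OPEN, nothing asserted; the census value (OPEN-NO-LINE) does not change.  The line's
obligations (K2 `CesaroCalm`, supports P / U) are NOT typed here.  No summit statement is proved here.
-/

noncomputable section

-- the summit and its single problem share the name `NavierStokesRegularity` (D-0017 nested layout)
set_option linter.dupNamespace false

open MeasureTheory Set Filter Topology Function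
open scoped ENNReal NNReal

namespace Summit.NavierStokesRegularity.NavierStokesRegularity.Theorems.ScenarioCensus

open Literature.Analysis Literature.Analysis.FluidPDE

/-! ## Row A8per — the time-periodic (recurrent) stratum of row A8 (cesaro-calm rev 2 :223) -/

/-- **Row A8per** (any bounded type · HELICAL, pitch `h ≠ 0` · bounded ancient mild (duality form `ν = 1`),
measurable slices · TIME-PERIODIC: `u (t − τ) = u t` for some period `τ > 0` and all `t < 0` — rotating waves, axially
travelling waves (the same thing for a screw-invariant field), standing / modulated helical waves, breathers): every
slice is a.e. constant.  VERBATIM `Row_A8per` (cesaro-calm rev 2 :223).  Sub-cell of row A8 (`row_A8per_of_row_A8`) and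
of row A8rec (`row_A8per_of_row_A8rec`).  OPEN — nothing asserted.
[cite: KochNadirashviliSereginSverak2009, §1 conjecture (L) and Thm 5.1 (arXiv:0709.3599)] -/
@[conjecture] def Row_A8per : Prop :=
  ∀ h : ℝ, h ≠ 0 → ∀ u : ℝ → EuclideanSpace ℝ (Fin 3) → EuclideanSpace ℝ (Fin 3),
    FluidPDE.IsBoundedAncientMildSolution 1 u → (∀ t < 0, AEStronglyMeasurable (u t) volume) →
      (∀ t < 0, ∀ (θ : ℝ) (x : EuclideanSpace ℝ (Fin 3)),
          u t (FluidPDE.rotZ θ x + (h * θ) • EuclideanSpace.single 2 (1 : ℝ)) = FluidPDE.rotZ θ (u t x)) →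
        (∃ τ : ℝ, 0 < τ ∧ ∀ t < 0, u (t - τ) = u t) →
          ∀ t < 0, ∃ b : EuclideanSpace ℝ (Fin 3), u t =ᵐ[volume] fun _ => b

/-- **A8 ⇒ A8per** (cesaro-calm :251): the periodicity hypothesis is carried, not used. [folklore] -/
theorem row_A8per_of_row_A8 (h8 : Row_A8) : Row_A8per :=
  fun h hh u hu hmeas hscrew _ => h8 h hh u hu hmeas hscrew

/-! ## A8rec ⊇ A8per: periodic ⇒ uniformly recurrent (backward-hull :317–:364, VERBATIM) -/

/-- `pairVar f f = 0`. [folklore] -/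
theorem pairVar_self (c : EuclideanSpace ℝ (Fin 3)) (r : ℝ)
    (f : EuclideanSpace ℝ (Fin 3) → EuclideanSpace ℝ (Fin 3)) : pairVar c r f f = 0 := by
  simp [pairVar]

/-- Iterating a backward period: `u (t − k τ) = u t` for all `k : ℕ`, `t < 0`. [folklore] -/
theorem periodic_iter {u : ℝ → EuclideanSpace ℝ (Fin 3) → EuclideanSpace ℝ (Fin 3)} {τ : ℝ} (hτ : 0 < τ)
    (hper : ∀ t < 0, u (t - τ) = u t) :
    ∀ k : ℕ, ∀ t < 0, u (t - k * τ) = u t := by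
  intro k
  induction k with
  | zero => intro t _; simp
  | succ k ih =>
      intro t ht
      have h1 : t - (k : ℝ) * τ < 0 := by
        have : (0 : ℝ) ≤ (k : ℝ) * τ := by positivity
        linarith
      have := hper (t - k * τ) h1
      rw [ih t ht] at this
      rw [← this]
      congr 1
      push_cast
      ring

/-- **Periodic ⇒ uniformly recurrent** (gap bound = the period; the almost-periods are exact periods):
a field with a backward period `τ > 0` on `t < 0` is uniformly recurrent in the sense of `IsUniformlyRecurrent`
(every past interval `[a − τ, a]`, `a < 0`, contains a negative multiple `−kτ` of the period, and
`pairVar 0 R (u (t − kτ)) (u t) = pairVar 0 R (u t) (u t) = 0`). [folklore] -/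
theorem isUniformlyRecurrent_of_periodic {u : ℝ → EuclideanSpace ℝ (Fin 3) → EuclideanSpace ℝ (Fin 3)} {τ : ℝ}
    (hτ : 0 < τ) (hper : ∀ t < 0, u (t - τ) = u t) : IsUniformlyRecurrent u := by
  intro ε hε R hR
  refine ⟨τ, hτ, fun a ha => ?_⟩
  -- the multiple `k τ` of the period with `k τ ∈ [−a, −a + τ)`
  set k : ℕ := ⌈(-a) / τ⌉₊ with hk
  have hk₁ : -a ≤ (k : ℝ) * τ := by
    have : (-a) / τ ≤ (k : ℝ) := Nat.le_ceil _
    rwa [div_le_iff₀ hτ] at this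
  have hk₂ : (k : ℝ) * τ < -a + τ := by
    have h0 : 0 ≤ (-a) / τ := div_nonneg (by linarith) hτ.le
    have : (k : ℝ) < (-a) / τ + 1 := Nat.ceil_lt_add_one h0
    have := (mul_lt_mul_of_pos_right this hτ)
    rwa [add_mul, one_mul, div_mul_cancel₀ _ hτ.ne'] at this
  refine ⟨-(k * τ), ⟨by linarith, by linarith⟩, fun t ht => ?_⟩
  have : u (t + -(↑k * τ)) = u t := by
    rw [← sub_eq_add_neg]
    exact periodic_iter hτ hper k t ht.2
  rw [this, pairVar_self]
  exact bot_le

/-- **A8rec ⇒ A8per** (backward-hull :361): the uniformly recurrent cell contains the periodic one. [folklore] -/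
theorem row_A8per_of_row_A8rec (hrec : Row_A8rec) : Row_A8per := by
  intro h hh u hu hmeas hscrew hper t ht
  obtain ⟨τ, hτ, hper⟩ := hper
  exact hrec h hh u hu hmeas hscrew (isUniformlyRecurrent_of_periodic hτ hper) t ht

end Summit.NavierStokesRegularity.NavierStokesRegularity.Theorems.ScenarioCensus

end
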